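import Summits.BirchSwinnertonDyer.BirchSwinnertonDyer.Theses.SchneiderFreeAdditiveX3
import Summits.BirchSwinnertonDyer.BirchSwinnertonDyer.Theorems.SchneiderFreeAdditiveX3PotMultBranchIMCReductions
import Summits.BirchSwinnertonDyer.BirchSwinnertonDyer.Theorems.SchneiderFreeAdditiveX3GordTwoBranchIMCReceptacle
import Summits.BirchSwinnertonDyer.BirchSwinnertonDyer.Theorems.SchneiderFreeAdditiveX3StepLManinLinkOfKolyvagin
import HarnessLib

/-!
# Route `SchneiderFreeAdditiveX3` (rung K1 door), crux `PotMultBranchIMC` (item stmt-BirchSwinnertonDyer-19176):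
# the (M) RECEPTACLE for the registered stub `stub_divisibilityLe`, and where its content sits

Cell `bsd-schneider-ideate`, seat `bsd-schneider-door-c2` (prover, generation 2). HONEST FRAMING:
propositional/arithmetic bookkeeping on the route's own sockets; NOTHING is asserted about elliptic
curves, no `p`-adic `L`-function is constructed, no divisibility is claimed. The crux `PotMultBranchIMC`
(door direction `𝓛^{BDP} ∣ char_Λ X_Gr` at 𝟙 on the potentially MULTIPLICATIVE reducible cell (M),
composed with the Liu–Zhang–Zhang value, Manin slack `2·v_p(c)`) stays OPEN — Keller–Yin
(arXiv:2410.23241 §0.5, p. 15) name this case future work and nothing has appeared since; BSD is not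
advanced by this file; it is `--supports` material for item 19176.

## What is kernel-checked here

The registered BC3 skeleton of item 19176 (sha 66f7551f…) has two stubs: `stub_charTorsion` (landed
from crux r4 by `stub_charTorsion_of_anticycControlAdditive`, file
`SchneiderFreeAdditiveX3PotMultBranchIMCReductions.lean`) and `stub_divisibilityLe`. For the latter:

* §1 (pointwise, every `p`) **where the content of the stub sits, GIVEN the control equality of crux
  r4 at the frame** (`AdditiveControlOnTreeAt`:
  `ord_p f(0) = ord_p #Ш(E/K)[p^∞] + 2(ord_p log_{ω_E} P − ord_p[E(K):ℤP]) + ord_p ∏_{w∣N⁺} c_w`):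
  the divisibility-stub inequality `2·ord_p log_{ω_E} P ≤ ord_p f(0) + 2s` is AUTOMATIC whenever
  `ord_p[E(K):ℤP] ≤ s` (`divisibilityLe_of_control_of_index_le_slack`), in particular at a datum with
  `p ∤ [E(K):ℤP_K]` (`divisibilityLe_of_control_of_index_unit`, `additiveIMCLowerBDPOnTreeLeAt_of_control_of_index_unit`),
  and it is CONTENT-FREE at a frame with `ord_p log_{ω_E} P ≤ s` (`divisibilityLe_of_padicLogOrd_le`,
  `additiveIMCLowerBDPOnTreeLeAt_of_control_of_padicLogOrd_le`). Class level:
  `potMultBranchIMC_of_anticycControlAdditive_of_indexLe_of_dvd` — the crux BY NAME from crux r4 and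
  the frame-free STEP-L inequality asked ONLY at the (M)-data with `p ∣ [E(K):ℤP_K]` (sharpening door-c2
  g0's `potMultBranchIMC_of_anticycControlAdditive_of_indexLe`). So, modulo crux r4, the crux's
  mathematical content is carried exactly by the Heegner data with `p ∣ [E(K):ℤP_K]` — on X3 the
  generic case (Tamagawa divisibility of the Heegner index at the reducible prime), which is why no
  per-pair certificate road replaces it.
* §2 (class level, cell (M), registered signature VERBATIM) **the receptacle**:
  `potMult_stub_divisibilityLe_of_halves` — `stub_divisibilityLe` ⇐ a supply, at every (M)-datum and
  every anticyclotomic frame `(κ, γ, 𝔭)` with `𝔭 ∣ p` of degree one, of `L ∈ R₀⟦T⟧` and an INTEGRAL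
  cofactor `u ∈ R₀` with `Ch_Λ(X_ac^∅(E_K[p^∞]))·R₀⟦T⟧ ⊆ (L)` (the door direction of a branch main
  conjecture) and `L(0) = u·(log_{ω_E} P / c)²` (the value at 𝟙, intrinsic to the newform:
  `log_{ω_E} = c·log_{ω_f}`) — the (M) twin of door-c3's `gordTwo_stub_divisibilityLe_of_halves`
  (item 19177), through door-c3's pointwise `divisibilityLe_of_value_of_dvd` (norm algebra in `ℂ_p`,
  no Euler-type factor spent: `a_p(E) = 0`, `ε_p = 0` at an additive prime);
  `potMultBranchIMC_of_anticycControlAdditive_of_halves` — the crux BY NAME from crux r4 and the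
  halves; `additiveStepLInputManinAt_subM_of_kolyvagin_of_control_of_halves` — the (M) half of the
  route's TARGET `StepLManin` from Kolyvagin's finiteness (`kolyvagin`, a `PrintedFacts` conjunct),
  crux r4 and the halves (through door-c2 g0's `additiveStepLInputManinAt_of_kolyvagin_of_potMult_of_control`).

Net for the planner / tribunal: on (M) the door needs ONE object — an integral anticyclotomic
`L ∈ Λ_{R₀}` for `f_E = f̃ ⊗ ε` (`f̃` multiplicative Eisenstein at `p`, `ε` quadratic of conductor `p`)
with the Greenberg divisibility toward `X_ac^∅` and the Liu–Zhang–Zhang value at 𝟙; everything else on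
the (M) side of the route is kernel plumbing already in the tree.

## What this does NOT do
No claim on `PotMultBranchIMC`, `AnticycControlAdditive`, `StepLManin`; nothing is booked; no label
changes; no Literature fact is minted (the missing object is NOT in print, so it is not a fact).

References: Keller–Yin, arXiv:2410.23241 §0.2 p. 4, §0.5 p. 5, §3.1 p. 15 (the potentially
multiplicative case deferred: «due to the lack of tools of studying Perrin-Riou's regulator map»);
Jetchev–Skinner–Wan, Camb. J. Math. 5 (2017) §7.4.1 (arXiv:1512.06894 p. 30); Liu–Zhang–Zhang, Duke
Math. J. 167 (2018) Thm. 1.8 (arXiv:1511.08172 p. 5); Castella, Camb. J. Math. 6 (2018) §5 (5.1)–(5.3).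
-/

noncomputable section

open scoped Classical

open WeierstrassCurve NumberField IsDedekindDomain Field PowerSeries
  Literature.NumberTheory.EllipticCurves
  Literature.NumberTheory.EllipticCurves.ModularForms
  Literature.NumberTheory.EllipticCurves.GreenbergSelmer
  Literature.NumberTheory.EllipticCurves.Rank1Residual
  Literature.NumberTheory.EllipticCurves.Rank1Residual.Typed
  Summit.BirchSwinnertonDyer.Rank1Residual
  Summit.BirchSwinnertonDyer.Rank1Residual.X11b
  Summit.BirchSwinnertonDyer.Rank1Residual.X11b.AcSelmer
  Summit.BirchSwinnertonDyer.Rank1Residual.X11b.Halves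
  Summit.BirchSwinnertonDyer.Rank1Residual.X11b.CongruenceLimit
  Summit.BirchSwinnertonDyer.BirchSwinnertonDyer.Theses.SchneiderFreeAdditiveX3

-- D-0017 layout: summit = sub-problem, so `Summit.BirchSwinnertonDyer.BirchSwinnertonDyer.…` is the
-- mandated namespace (same option as the route's sockets files).
set_option linter.dupNamespace false
set_option autoImplicit false

namespace Summit.BirchSwinnertonDyer.BirchSwinnertonDyer.Theorems.SchneiderFree

/-! ## §1 Pointwise: where the content of `stub_divisibilityLe` sits, given the control equality -/

section Pointwise

variable {p : ℕ} [Fact p.Prime] {K : Type} [Field K] [NumberField K]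
  {W : WeierstrassCurve ℚ} [W.IsElliptic] [W.IsGloballyMinimal] {κ : ZpExtension K p}
  {𝔭 : HeightOneSpectrum (𝓞 K)} {γ : Field.absoluteGaloisGroup K} [Fact (κ.IsTopGenerator γ)]
  {ι : K →+* ℚ_[p]} {P : (W.baseChange K).toAffine.Point}

/-- **Given control, the divisibility-stub inequality is automatic when the index is within the slack.**
If the control equality T-B6-2′ holds at a frame
(`ord_p f(0) = ord_p #Ш(E/K)[p^∞] + 2(ord_p log_{ω_E} P − ord_p[E(K):ℤP]) + ord_p ∏ c_w`) and
`ord_p[E(K):ℤP] ≤ s`, then EVERY `HasCharValuationAt`-witness `n` satisfies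
`2·ord_p log_{ω_E} P ≤ n + 2s` (the two non-negative terms `ord_p #Ш[p^∞]`, `ord_p ∏ c_w` are simply
dropped; the witness is unique). [cite: JetchevSkinnerWan2017, §7.4.1 (arXiv:1512.06894 p. 30)] -/
theorem divisibilityLe_of_control_of_index_le_slack {s : ℕ}
    (hC : AdditiveControlOnTreeAt p κ 𝔭 γ ι P)
    (hI : padicValNat p (AddSubgroup.zmultiples P).index ≤ s) :
    ∀ n : ℕ, XAc.HasCharValuationAt (W.baseChange K) p κ 𝔭 ∅ γ n →
      2 * X11b.padicLogOrd W p ι P ≤ (n : ℤ) + 2 * (s : ℤ) := by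
  intro n hn
  obtain ⟨n', hn', heq⟩ := hC
  obtain rfl : n = n' := hn.unique hn'
  have hI' : (padicValNat p (AddSubgroup.zmultiples P).index : ℤ) ≤ (s : ℤ) := by exact_mod_cast hI
  have h0 : (0 : ℤ) ≤
      (padicValNat p (Nat.card (AddCommGroup.primaryComponent (W.baseChange K).sha p)) : ℤ) :=
    by positivity
  have h1 : (0 : ℤ) ≤ (padicValNat p (X11b.tamagawaProductSplit W K) : ℤ) := by positivity
  omega

/-- **The unit-index regime.** Given control at a frame, at a datum with `p ∤ [E(K):ℤP]` every
`HasCharValuationAt`-witness `n` satisfies `2·ord_p log_{ω_E} P ≤ n + 2s` for EVERY slack `s` (in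
particular the Manin slack `v_p(c)`): there the registered stub has no content beyond crux r4.
[cite: JetchevSkinnerWan2017, §7.4.1 (arXiv:1512.06894 p. 30)] -/
theorem divisibilityLe_of_control_of_index_unit (s : ℕ)
    (hC : AdditiveControlOnTreeAt p κ 𝔭 γ ι P)
    (hI : ¬ p ∣ (AddSubgroup.zmultiples P).index) :
    ∀ n : ℕ, XAc.HasCharValuationAt (W.baseChange K) p κ 𝔭 ∅ γ n →
      2 * X11b.padicLogOrd W p ι P ≤ (n : ℤ) + 2 * (s : ℤ) := by
  refine divisibilityLe_of_control_of_index_le_slack hC ?_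
  rw [padicValNat.eq_zero_of_not_dvd hI]
  exact Nat.zero_le s

/-- **The socket in the unit-index regime.** Given control at a frame and `p ∤ [E(K):ℤP]`, the
slack-`s` socket `AdditiveIMCLowerBDPOnTreeLeAt … s P` holds for every `s` (door-c2 g0's converse
bookkeeping `additiveIMCLowerBDPOnTreeLeAt_of_control_of_index_le` with a trivially true index
inequality). [cite: JetchevSkinnerWan2017, §7.4.1 (arXiv:1512.06894 p. 30)] -/
theorem additiveIMCLowerBDPOnTreeLeAt_of_control_of_index_unit (s : ℕ)
    (hC : AdditiveControlOnTreeAt p κ 𝔭 γ ι P)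
    (hI : ¬ p ∣ (AddSubgroup.zmultiples P).index) :
    AdditiveIMCLowerBDPOnTreeLeAt p κ 𝔭 γ ι s P :=
  additiveIMCLowerBDPOnTreeLeAt_of_control_of_bound hC (divisibilityLe_of_control_of_index_unit s hC hI)

/-- **The stub is content-free where the logarithm is within the slack.** If
`ord_p log_{ω_E} P ≤ s` at a frame, the divisibility-stub inequality `2·ord_p log_{ω_E} P ≤ n + 2s`
holds for every `n : ℕ` with no input at all (so, at the Manin slack, the crux speaks only about the
data with `ord_p log_{ω_E} P_K > v_p(c)`). [folklore] -/
theorem divisibilityLe_of_padicLogOrd_le {s : ℕ} (hlog : X11b.padicLogOrd W p ι P ≤ (s : ℤ)) :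
    ∀ n : ℕ, XAc.HasCharValuationAt (W.baseChange K) p κ 𝔭 ∅ γ n →
      2 * X11b.padicLogOrd W p ι P ≤ (n : ℤ) + 2 * (s : ℤ) := by
  intro n _
  have h0 : (0 : ℤ) ≤ (n : ℤ) := by positivity
  omega

/-- The socket at a frame where the logarithm is within the slack, given control (which supplies the
`HasCharValuationAt` witness). [folklore] -/
theorem additiveIMCLowerBDPOnTreeLeAt_of_control_of_padicLogOrd_le {s : ℕ}
    (hC : AdditiveControlOnTreeAt p κ 𝔭 γ ι P) (hlog : X11b.padicLogOrd W p ι P ≤ (s : ℤ)) :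
    AdditiveIMCLowerBDPOnTreeLeAt p κ 𝔭 γ ι s P :=
  additiveIMCLowerBDPOnTreeLeAt_of_control_of_bound hC (divisibilityLe_of_padicLogOrd_le hlog)

end Pointwise

/-! ## §2 Class level, cell (M): the receptacle on the registered skeleton of item 19176 -/

/-- **`PotMultBranchIMC` (BY NAME) ⇐ crux r4 + STEP L over `K` on the `p`-DIVISIBLE-INDEX data of (M)
only.** Door-c2 g0's `potMultBranchIMC_of_anticycControlAdditive_of_indexLe` asks for the frame-free
inequality `2·ord_p[E(K):ℤP] ≤ ord_p #Ш(E/K)[p^∞] + ord_p ∏_{w∣N⁺} c_w + 2·v_p(c)` at EVERY (M)-datum; it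
is enough to ask for it at the data with `p ∣ [E(K):ℤP_K]` — at the others the socket is automatic
given control (`additiveIMCLowerBDPOnTreeLeAt_of_control_of_index_unit`). This is the class-level form
of «the crux's content sits on the `p`-divisible Heegner-index data». CONDITIONAL on crux r4 and on that
restricted inequality (open). [cite: JetchevSkinnerWan2017, §7.4.1 (arXiv:1512.06894 p. 30)] -/
theorem potMultBranchIMC_of_anticycControlAdditive_of_indexLe_of_dvd
    (h4 : Theses.SchneiderFreeAdditiveX3.AnticycControlAdditive)
    (hI :
    ∀ (W : WeierstrassCurve ℚ) [W.IsElliptic] [W.IsGloballyMinimal] (p : ℕ) [Fact p.Prime],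
      W.analyticRank = 1 → p ≠ 2 → ClassX3 W p → Additive.SubM W p →
      ∀ (N : ℕ) [NeZero N] (K : Type) [Field K] [NumberField K]
        (Dt : ModularParametrizationData W N) (H : HeegnerDatum N (NumberField.discr K)) (ι : K →+* ℂ)
        (P : (W.baseChange K).toAffine.Point),
        W.analyticRank = 1 → Additive.N10.Locus W p → W.conductorNorm ℤ = N → IsImaginaryQuadratic K →
        Odd (NumberField.discr K) → ¬ p ∣ Units.torsionOrder K → SatisfiesHeegnerHypothesis N K →
        (W.quadraticTwist (NumberField.discr K : ℚ)).entireLFunction 1 ≠ 0 →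
        WeierstrassCurve.Affine.Point.map ι.toRatAlgHom P = heegnerPointComplex Dt H →
        ¬ IsOfFinAddOrder P → p ∣ (AddSubgroup.zmultiples P).index →
        2 * (padicValNat p (AddSubgroup.zmultiples P).index : ℤ) ≤
          (padicValNat p (Nat.card (AddCommGroup.primaryComponent (W.baseChange K).sha p)) : ℤ) +
            padicValNat p (X11b.tamagawaProductSplit W K) + 2 * (padicValNat p Dt.c.natAbs : ℤ)) :
    Theses.SchneiderFreeAdditiveX3.PotMultBranchIMC := by
  intro W _ _ p _ hr hp2 hX hS N _ K _ _ Dt H ι P hr' hloc hN hK hodd hunit hHe hL hP hnt κ hκ γ _ 𝔭 h𝔭 he hf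
  have hS' : Additive.SubSemistableTwist W p := Or.inl hS
  have hC := h4 W p hr hp2 hX hS' N K Dt H ι P hr' hloc hN hK hodd hunit hHe hL hP hnt κ hκ γ 𝔭 h𝔭 he hf
  by_cases hdvd : p ∣ (AddSubgroup.zmultiples P).index
  · exact additiveIMCLowerBDPOnTreeLeAt_of_control_of_index_le hC
      (hI W p hr hp2 hX hS N K Dt H ι P hr' hloc hN hK hodd hunit hHe hL hP hnt hdvd)
  · exact additiveIMCLowerBDPOnTreeLeAt_of_control_of_index_unit _ hC hdvd

/-- **`stub_divisibilityLe` (item 19176, signature verbatim) ⇐ a supply of HALVES on (M).** If at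
every datum of the crux `PotMultBranchIMC` and every anticyclotomic frame `(κ, γ, 𝔭)` with `𝔭 ∣ p` of
degree one there are `L ∈ R₀⟦T⟧` and an integral cofactor `u ∈ R₀` with
`Ch_Λ(X_ac^∅(E_K[p^∞]))·R₀⟦T⟧ ⊆ (L)` (door direction of the branch main conjecture for
`f_E = f̃ ⊗ ε`, `f̃` multiplicative Eisenstein at `p` — NOT in print) and `L(0) = u·(log_{ω_E} P / c)²`,
`c = Dt.c` (Liu–Zhang–Zhang value at 𝟙, intrinsic to the newform), then the registered divisibility
stub holds. The (M) twin of `gordTwo_stub_divisibilityLe_of_halves`; the pointwise step is door-c3's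
`divisibilityLe_of_value_of_dvd`. CONDITIONAL on the halves (open).
[cite: Castella2018, §5 (5.1)–(5.3) (arXiv:1704.06608 p. 12) (the assembly, as an inequality)]
[cite: LiuZhangZhang2018, Thm. 1.8] -/
theorem potMult_stub_divisibilityLe_of_halves
    (hH :
    ∀ (W : WeierstrassCurve ℚ) [W.IsElliptic] [W.IsGloballyMinimal] (p : ℕ) [Fact p.Prime],
      W.analyticRank = 1 → p ≠ 2 → ClassX3 W p → Additive.SubM W p →
      ∀ (N : ℕ) [NeZero N] (K : Type) [Field K] [NumberField K]
        (Dt : ModularParametrizationData W N) (H : HeegnerDatum N (NumberField.discr K)) (ι : K →+* ℂ)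
        (P : (W.baseChange K).toAffine.Point),
        W.analyticRank = 1 → Additive.N10.Locus W p → W.conductorNorm ℤ = N → IsImaginaryQuadratic K →
        Odd (NumberField.discr K) → ¬ p ∣ Units.torsionOrder K → SatisfiesHeegnerHypothesis N K →
        (W.quadraticTwist (NumberField.discr K : ℚ)).entireLFunction 1 ≠ 0 →
        WeierstrassCurve.Affine.Point.map ι.toRatAlgHom P = heegnerPointComplex Dt H →
        ¬ IsOfFinAddOrder P →
        ∀ (κ : ZpExtension K p), κ.IsAnticyclotomic →
          ∀ (γ : Field.absoluteGaloisGroup K) [Fact (κ.IsTopGenerator γ)]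
            (𝔭 : HeightOneSpectrum (𝓞 K)) (h𝔭 : ((p : ℕ) : 𝓞 K) ∈ 𝔭.asIdeal)
            (he : 𝔭.asIdeal.ramificationIdx (𝓞 ℚ) = 1) (hf : 𝔭.asIdeal.inertiaDeg (𝓞 ℚ) = 1),
            ∃ (L : UnrSeries p) (u : unrIntegers p),
              (XAc.charIdeal (W.baseChange K) p κ 𝔭 ∅ γ).map (PowerSeries.map (toUnr p)) ≤
                Ideal.span {L} ∧
              L.HasValueAt 0 (((u : unrIntegers p) : ℂ_[p]) *
                (algebraMap ℚ_[p] ℂ_[p]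
                  (logOmega W p (embAt K p 𝔭 h𝔭 he hf) P / (Dt.c : ℚ_[p]))) ^ 2)) :
    ∀ (W : WeierstrassCurve ℚ) [W.IsElliptic] [W.IsGloballyMinimal] (p : ℕ) [Fact p.Prime],
      W.analyticRank = 1 → p ≠ 2 → ClassX3 W p → Additive.SubM W p →
      ∀ (N : ℕ) [NeZero N] (K : Type) [Field K] [NumberField K]
        (Dt : ModularParametrizationData W N) (H : HeegnerDatum N (NumberField.discr K)) (ι : K →+* ℂ)
        (P : (W.baseChange K).toAffine.Point),
        W.analyticRank = 1 → Additive.N10.Locus W p → W.conductorNorm ℤ = N → IsImaginaryQuadratic K →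
        Odd (NumberField.discr K) → ¬ p ∣ Units.torsionOrder K → SatisfiesHeegnerHypothesis N K →
        (W.quadraticTwist (NumberField.discr K : ℚ)).entireLFunction 1 ≠ 0 →
        WeierstrassCurve.Affine.Point.map ι.toRatAlgHom P = heegnerPointComplex Dt H →
        ¬ IsOfFinAddOrder P →
        ∀ (κ : ZpExtension K p), κ.IsAnticyclotomic →
          ∀ (γ : Field.absoluteGaloisGroup K) [Fact (κ.IsTopGenerator γ)]
            (𝔭 : HeightOneSpectrum (𝓞 K)) (h𝔭 : ((p : ℕ) : 𝓞 K) ∈ 𝔭.asIdeal)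
            (he : 𝔭.asIdeal.ramificationIdx (𝓞 ℚ) = 1) (hf : 𝔭.asIdeal.inertiaDeg (𝓞 ℚ) = 1),
            ∀ n : ℕ, XAc.HasCharValuationAt (W.baseChange K) p κ 𝔭 ∅ γ n →
              2 * X11b.padicLogOrd W p (embAt K p 𝔭 h𝔭 he hf) P ≤
                (n : ℤ) + 2 * (padicValNat p Dt.c.natAbs : ℤ) := by
  intro W _ _ p _ hr hp2 hX hS N _ K _ _ Dt H ι P hr' hloc hN hK hodd hunit hHe hL hP hnt κ hκ γ _ 𝔭
    h𝔭 he hf n hn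
  obtain ⟨L, u, h3, h2⟩ := hH W p hr hp2 hX hS N K Dt H ι P hr' hloc hN hK hodd hunit hHe hL hP hnt κ
    hκ γ 𝔭 h𝔭 he hf
  exact divisibilityLe_of_value_of_dvd hn h3 u Dt.c h2

/-- **`PotMultBranchIMC` (BY NAME) ⇐ crux r4 `AnticycControlAdditive` + the halves on (M).** The control
crux supplies the `HasCharValuationAt` witness at every frame (registered `stub_charTorsion`, by
`stub_charTorsion_of_anticycControlAdditive`), the halves supply the divisibility stub
(`potMult_stub_divisibilityLe_of_halves`), and the registered composition gives the crux
(`potMultBranchIMC_of_anticycControlAdditive_of_divisibilityLe`). CONDITIONAL on both hypotheses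
(open). [cite: JetchevSkinnerWan2017, §7.4.1 (arXiv:1512.06894 p. 30)] -/
theorem potMultBranchIMC_of_anticycControlAdditive_of_halves
    (h4 : Theses.SchneiderFreeAdditiveX3.AnticycControlAdditive)
    (hH :
    ∀ (W : WeierstrassCurve ℚ) [W.IsElliptic] [W.IsGloballyMinimal] (p : ℕ) [Fact p.Prime],
      W.analyticRank = 1 → p ≠ 2 → ClassX3 W p → Additive.SubM W p →
      ∀ (N : ℕ) [NeZero N] (K : Type) [Field K] [NumberField K]
        (Dt : ModularParametrizationData W N) (H : HeegnerDatum N (NumberField.discr K)) (ι : K →+* ℂ)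
        (P : (W.baseChange K).toAffine.Point),
        W.analyticRank = 1 → Additive.N10.Locus W p → W.conductorNorm ℤ = N → IsImaginaryQuadratic K →
        Odd (NumberField.discr K) → ¬ p ∣ Units.torsionOrder K → SatisfiesHeegnerHypothesis N K →
        (W.quadraticTwist (NumberField.discr K : ℚ)).entireLFunction 1 ≠ 0 →
        WeierstrassCurve.Affine.Point.map ι.toRatAlgHom P = heegnerPointComplex Dt H →
        ¬ IsOfFinAddOrder P →
        ∀ (κ : ZpExtension K p), κ.IsAnticyclotomic →
          ∀ (γ : Field.absoluteGaloisGroup K) [Fact (κ.IsTopGenerator γ)]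
            (𝔭 : HeightOneSpectrum (𝓞 K)) (h𝔭 : ((p : ℕ) : 𝓞 K) ∈ 𝔭.asIdeal)
            (he : 𝔭.asIdeal.ramificationIdx (𝓞 ℚ) = 1) (hf : 𝔭.asIdeal.inertiaDeg (𝓞 ℚ) = 1),
            ∃ (L : UnrSeries p) (u : unrIntegers p),
              (XAc.charIdeal (W.baseChange K) p κ 𝔭 ∅ γ).map (PowerSeries.map (toUnr p)) ≤
                Ideal.span {L} ∧
              L.HasValueAt 0 (((u : unrIntegers p) : ℂ_[p]) *
                (algebraMap ℚ_[p] ℂ_[p]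
                  (logOmega W p (embAt K p 𝔭 h𝔭 he hf) P / (Dt.c : ℚ_[p]))) ^ 2)) :
    Theses.SchneiderFreeAdditiveX3.PotMultBranchIMC :=
  potMultBranchIMC_of_anticycControlAdditive_of_divisibilityLe h4
    (potMult_stub_divisibilityLe_of_halves hH)

/-- **The (M) half of the route's TARGET `StepLManin` ⇐ Kolyvagin + crux r4 + the halves on (M).**
Kolyvagin's finiteness of `Ш(E/K)` at a non-torsion Heegner point (the `kolyvagin` conjunct of the
route's `PrintedFacts`), the control crux and the halves give `AdditiveStepLInputManinAt W p` (STEP L,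
Manin-robust) for every pair on the potentially multiplicative reducible cell — through door-c2 g0's
`additiveStepLInputManinAt_of_kolyvagin_of_potMult_of_control`. CONDITIONAL on the three hypotheses
(the first printed, the other two open).
[cite: JetchevSkinnerWan2017, §7.4.1 (arXiv:1512.06894 p. 30)] [cite: Gross1991, Thm. 1.3] -/
theorem additiveStepLInputManinAt_subM_of_kolyvagin_of_control_of_halves
    (hKo : ∀ (N : ℕ) [NeZero N] (W : WeierstrassCurve ℚ) (K : Type) [Field K] [NumberField K],
      Literature.NumberTheory.EllipticCurves.kolyvagin N W K)
    (h4 : Theses.SchneiderFreeAdditiveX3.AnticycControlAdditive)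
    (hH :
    ∀ (W : WeierstrassCurve ℚ) [W.IsElliptic] [W.IsGloballyMinimal] (p : ℕ) [Fact p.Prime],
      W.analyticRank = 1 → p ≠ 2 → ClassX3 W p → Additive.SubM W p →
      ∀ (N : ℕ) [NeZero N] (K : Type) [Field K] [NumberField K]
        (Dt : ModularParametrizationData W N) (H : HeegnerDatum N (NumberField.discr K)) (ι : K →+* ℂ)
        (P : (W.baseChange K).toAffine.Point),
        W.analyticRank = 1 → Additive.N10.Locus W p → W.conductorNorm ℤ = N → IsImaginaryQuadratic K →
        Odd (NumberField.discr K) → ¬ p ∣ Units.torsionOrder K → SatisfiesHeegnerHypothesis N K →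
        (W.quadraticTwist (NumberField.discr K : ℚ)).entireLFunction 1 ≠ 0 →
        WeierstrassCurve.Affine.Point.map ι.toRatAlgHom P = heegnerPointComplex Dt H →
        ¬ IsOfFinAddOrder P →
        ∀ (κ : ZpExtension K p), κ.IsAnticyclotomic →
          ∀ (γ : Field.absoluteGaloisGroup K) [Fact (κ.IsTopGenerator γ)]
            (𝔭 : HeightOneSpectrum (𝓞 K)) (h𝔭 : ((p : ℕ) : 𝓞 K) ∈ 𝔭.asIdeal)
            (he : 𝔭.asIdeal.ramificationIdx (𝓞 ℚ) = 1) (hf : 𝔭.asIdeal.inertiaDeg (𝓞 ℚ) = 1),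
            ∃ (L : UnrSeries p) (u : unrIntegers p),
              (XAc.charIdeal (W.baseChange K) p κ 𝔭 ∅ γ).map (PowerSeries.map (toUnr p)) ≤
                Ideal.span {L} ∧
              L.HasValueAt 0 (((u : unrIntegers p) : ℂ_[p]) *
                (algebraMap ℚ_[p] ℂ_[p]
                  (logOmega W p (embAt K p 𝔭 h𝔭 he hf) P / (Dt.c : ℚ_[p]))) ^ 2)) :
    ∀ (W : WeierstrassCurve ℚ) [W.IsElliptic] [W.IsGloballyMinimal] (p : ℕ) [Fact p.Prime],
      W.analyticRank = 1 → p ≠ 2 → ClassX3 W p → Additive.SubM W p →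
        AdditiveStepLInputManinAt W p :=
  additiveStepLInputManinAt_of_kolyvagin_of_potMult_of_control hKo
    (potMultBranchIMC_of_anticycControlAdditive_of_halves h4 hH) h4

end Summit.BirchSwinnertonDyer.BirchSwinnertonDyer.Theorems.SchneiderFree

end
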